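import Summits.CriticalPhenomena.PercolationContinuityZ3.Theorems.PercNearOneGluingNoHeavyLowerTailKNGoodThreeRelaysKNCells
import HarnessLib

/-!
# `NoHeavyLowerTail` (stmt-CriticalPhenomena-4575) — pocket lift of Kozma–Nitzan's Theorem 2: the worlds of `b`

Support file (`--supports stmt-CriticalPhenomena-4575`, hull-port prover `prim-hp-2`, gen 23).  No named facts, no sorries; standard axioms.
Kozma–Nitzan's masses `m_S` (arXiv:2401.12397 p. 8) for three relays `a, t, c` as measures of (II)-cells: `P(c↔b)`, `P(a↔b)`, `P(t↔b)` split
along the separation events `D_K, D_a, D_t`, and `m_c = μ({c↔b} ∩ D_K)`, `m_{at} = μ({a↔t, b ∈ C_{at}} ∩ D_K)`.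
[cite: KozmaNitzan2024, Thm. 2 (p. 8)]
-/

noncomputable section

namespace Summit.CriticalPhenomena.PercolationContinuityZ3.Theorems

open MeasureTheory Set Literature.Probability.LatticeModels Literature.Probability.Percolation
open scoped Classical

namespace KNGoodThreeKN

open KNGoodPocketBHK

variable {V : Type*} [Fintype V]

/-- `P(c↔b) = P(c↔b, a↔b) + μ({c↔b} ∩ D_K) + μ({t↔c, t↔b} ∩ D_a)`. [cite: KozmaNitzan2024, Thm. 2 proof, (7) (p. 8)] -/
theorem real_cb_split_a (w : Sym2 V → unitInterval) (a t c b : V) :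
    (prodBernoulli w).real (openConn c b) = (prodBernoulli w).real (openConn c b ∩ openConn a b) + (prodBernoulli w).real (openConn c b ∩ avoidSet ({a, t} : Set V) {c}) +
      (prodBernoulli w).real ((openConn t c ∩ openConn t b) ∩ avoidSet ({a} : Set V) {t, c}) := by
  classical
  set μ := prodBernoulli w with hμ
  have hmeas : ∀ A : Set (BondConfig V), MeasurableSet A := fun _ => MeasurableSet.of_discrete
  set DK : Set (BondConfig V) := avoidSet {a, t} {c} with hDK
  set Da : Set (BondConfig V) := avoidSet {a} {t, c} with hDa
  set Dt : Set (BondConfig V) := avoidSet {t} {a, c} with hDt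
  set h5 : Set (BondConfig V) := openConn a t ∩ (openConn a b ∪ openConn t b) with hh5
  set g9 : Set (BondConfig V) := openConn t c ∩ openConn t b with hg9
  set g8 : Set (BondConfig V) := openConn a c ∩ openConn a b with hg8
  have memDK : ∀ ω, ω ∈ DK ↔ ¬ (openGraph ω).Reachable a c ∧ ¬ (openGraph ω).Reachable t c := fun ω => by
    rw [hDK]; exact mem_avoidSet_two_one a t c ω
  have memDa : ∀ ω, ω ∈ Da ↔ ¬ (openGraph ω).Reachable a t ∧ ¬ (openGraph ω).Reachable a c := fun ω => by
    rw [hDa]; exact mem_avoidSet_one_two a t c ω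
  have memDt : ∀ ω, ω ∈ Dt ↔ ¬ (openGraph ω).Reachable t a ∧ ¬ (openGraph ω).Reachable t c := fun ω => by
    rw [hDt]; exact mem_avoidSet_one_two t a c ω
  have e : (openConn c b : Set (BondConfig V)) = openConn c b ∩ openConn a b ∪ openConn c b ∩ DK ∪ g9 ∩ Da := by
    ext ω
    simp only [Set.mem_union, Set.mem_inter_iff, memDK, memDa, hg9, openConn, Set.mem_setOf_eq]
    constructor
    · intro hcb
      by_cases hab' : (openGraph ω).Reachable a b
      · exact Or.inl (Or.inl ⟨hcb, hab'⟩)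
      · by_cases htb' : (openGraph ω).Reachable t b
        · refine Or.inr ⟨⟨htb'.trans hcb.symm, htb'⟩, fun hat => hab' (hat.trans htb'), ?_⟩
          exact fun hac => hab' (hac.trans hcb)
        · exact Or.inl (Or.inr ⟨hcb, fun hac => hab' (hac.trans hcb), fun htc => htb' (htc.trans hcb)⟩)
    · rintro ((⟨hcb, -⟩ | ⟨hcb, -⟩) | ⟨⟨htc, htb'⟩, -⟩)
      · exact hcb
      · exact hcb
      · exact htc.symm.trans htb'
  have d1 : Disjoint (openConn c b ∩ openConn a b ∪ openConn c b ∩ DK) (g9 ∩ Da) := by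
    rw [Set.disjoint_union_left]; constructor
    · rw [Set.disjoint_left]; rintro ω ⟨-, hab'⟩ ⟨⟨-, htb'⟩, hDa'⟩
      have hab'' : (openGraph ω).Reachable a b := hab'
      have htb'' : (openGraph ω).Reachable t b := htb'
      exact ((memDa ω).1 hDa').1 (hab''.trans htb''.symm)
    · rw [Set.disjoint_left]; rintro ω ⟨-, hDK'⟩ ⟨⟨htc, -⟩, -⟩
      exact ((memDK ω).1 hDK').2 htc
  have d2 : Disjoint (openConn c b ∩ openConn a b) (openConn c b ∩ DK) := by
    rw [Set.disjoint_left]; rintro ω ⟨hcb, hab'⟩ ⟨-, hDK'⟩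
    have hab'' : (openGraph ω).Reachable a b := hab'
    have hcb' : (openGraph ω).Reachable c b := hcb
    exact ((memDK ω).1 hDK').1 (hab''.trans hcb'.symm)
  conv_lhs => rw [e]
  rw [measureReal_union d1 (hmeas _), measureReal_union d2 (hmeas _)]

/-- `P(a↔b) = P(c↔b, a↔b) + μ({a↔t, b∈C_{at}} ∩ D_K) + μ({a↔b} ∩ D_a)`. [cite: KozmaNitzan2024, Thm. 2 proof, (7) (p. 8)] -/
theorem real_ab_split (w : Sym2 V → unitInterval) (a t c b : V) :
    (prodBernoulli w).real (openConn a b) = (prodBernoulli w).real (openConn c b ∩ openConn a b) + (prodBernoulli w).real ((openConn a t ∩ (openConn a b ∪ openConn t b)) ∩ avoidSet ({a, t} : Set V) {c}) +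
      (prodBernoulli w).real (openConn a b ∩ avoidSet ({a} : Set V) {t, c}) := by
  classical
  set μ := prodBernoulli w with hμ
  have hmeas : ∀ A : Set (BondConfig V), MeasurableSet A := fun _ => MeasurableSet.of_discrete
  set DK : Set (BondConfig V) := avoidSet {a, t} {c} with hDK
  set Da : Set (BondConfig V) := avoidSet {a} {t, c} with hDa
  set Dt : Set (BondConfig V) := avoidSet {t} {a, c} with hDt
  set h5 : Set (BondConfig V) := openConn a t ∩ (openConn a b ∪ openConn t b) with hh5
  set g9 : Set (BondConfig V) := openConn t c ∩ openConn t b with hg9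
  set g8 : Set (BondConfig V) := openConn a c ∩ openConn a b with hg8
  have memDK : ∀ ω, ω ∈ DK ↔ ¬ (openGraph ω).Reachable a c ∧ ¬ (openGraph ω).Reachable t c := fun ω => by
    rw [hDK]; exact mem_avoidSet_two_one a t c ω
  have memDa : ∀ ω, ω ∈ Da ↔ ¬ (openGraph ω).Reachable a t ∧ ¬ (openGraph ω).Reachable a c := fun ω => by
    rw [hDa]; exact mem_avoidSet_one_two a t c ω
  have memDt : ∀ ω, ω ∈ Dt ↔ ¬ (openGraph ω).Reachable t a ∧ ¬ (openGraph ω).Reachable t c := fun ω => by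
    rw [hDt]; exact mem_avoidSet_one_two t a c ω
  have e : (openConn a b : Set (BondConfig V)) = openConn c b ∩ openConn a b ∪ h5 ∩ DK ∪ openConn a b ∩ Da := by
    ext ω
    simp only [Set.mem_union, Set.mem_inter_iff, memDK, memDa, hh5, openConn, Set.mem_setOf_eq]
    constructor
    · intro hab'
      by_cases hcb : (openGraph ω).Reachable c b
      · exact Or.inl (Or.inl ⟨hcb, hab'⟩)
      · by_cases hat : (openGraph ω).Reachable a t
        · refine Or.inl (Or.inr ⟨⟨hat, Or.inl hab'⟩, fun hac => hcb (hac.symm.trans hab'), ?_⟩)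
          exact fun htc => hcb (htc.symm.trans (hat.symm.trans hab'))
        · exact Or.inr ⟨hab', hat, fun hac => hcb (hac.symm.trans hab')⟩
    · rintro ((⟨-, hab'⟩ | ⟨⟨hat, hb⟩, -⟩) | ⟨hab', -⟩)
      · exact hab'
      · rcases hb with h | h
        · exact h
        · exact hat.trans h
      · exact hab'
  have d1 : Disjoint (openConn c b ∩ openConn a b ∪ h5 ∩ DK) (openConn a b ∩ Da) := by
    rw [Set.disjoint_union_left]; constructor
    · rw [Set.disjoint_left]; rintro ω ⟨hcb, hab'⟩ ⟨-, hDa'⟩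
      have hab'' : (openGraph ω).Reachable a b := hab'
      have hcb' : (openGraph ω).Reachable c b := hcb
      exact ((memDa ω).1 hDa').2 (hab''.trans hcb'.symm)
    · rw [Set.disjoint_left]; rintro ω ⟨⟨hat, -⟩, -⟩ ⟨-, hDa'⟩
      exact ((memDa ω).1 hDa').1 hat
  have d2 : Disjoint (openConn c b ∩ openConn a b) (h5 ∩ DK) := by
    rw [Set.disjoint_left]; rintro ω ⟨hcb, hab'⟩ ⟨-, hDK'⟩
    have hab'' : (openGraph ω).Reachable a b := hab'
    have hcb' : (openGraph ω).Reachable c b := hcb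
    exact ((memDK ω).1 hDK').1 (hab''.trans hcb'.symm)
  conv_lhs => rw [e]
  rw [measureReal_union d1 (hmeas _), measureReal_union d2 (hmeas _)]

/-- `P(c↔b) = P(c↔b, t↔b) + μ({c↔b} ∩ D_K) + μ({a↔c, a↔b} ∩ D_t)`. [cite: KozmaNitzan2024, Thm. 2 proof, (7) (p. 8)] -/
theorem real_cb_split_t (w : Sym2 V → unitInterval) (a t c b : V) :
    (prodBernoulli w).real (openConn c b) = (prodBernoulli w).real (openConn c b ∩ openConn t b) + (prodBernoulli w).real (openConn c b ∩ avoidSet ({a, t} : Set V) {c}) +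
      (prodBernoulli w).real ((openConn a c ∩ openConn a b) ∩ avoidSet ({t} : Set V) {a, c}) := by
  classical
  set μ := prodBernoulli w with hμ
  have hmeas : ∀ A : Set (BondConfig V), MeasurableSet A := fun _ => MeasurableSet.of_discrete
  set DK : Set (BondConfig V) := avoidSet {a, t} {c} with hDK
  set Da : Set (BondConfig V) := avoidSet {a} {t, c} with hDa
  set Dt : Set (BondConfig V) := avoidSet {t} {a, c} with hDt
  set h5 : Set (BondConfig V) := openConn a t ∩ (openConn a b ∪ openConn t b) with hh5
  set g9 : Set (BondConfig V) := openConn t c ∩ openConn t b with hg9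
  set g8 : Set (BondConfig V) := openConn a c ∩ openConn a b with hg8
  have memDK : ∀ ω, ω ∈ DK ↔ ¬ (openGraph ω).Reachable a c ∧ ¬ (openGraph ω).Reachable t c := fun ω => by
    rw [hDK]; exact mem_avoidSet_two_one a t c ω
  have memDa : ∀ ω, ω ∈ Da ↔ ¬ (openGraph ω).Reachable a t ∧ ¬ (openGraph ω).Reachable a c := fun ω => by
    rw [hDa]; exact mem_avoidSet_one_two a t c ω
  have memDt : ∀ ω, ω ∈ Dt ↔ ¬ (openGraph ω).Reachable t a ∧ ¬ (openGraph ω).Reachable t c := fun ω => by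
    rw [hDt]; exact mem_avoidSet_one_two t a c ω
  have e : (openConn c b : Set (BondConfig V)) = openConn c b ∩ openConn t b ∪ openConn c b ∩ DK ∪ g8 ∩ Dt := by
    ext ω
    simp only [Set.mem_union, Set.mem_inter_iff, memDK, memDt, hg8, openConn, Set.mem_setOf_eq]
    constructor
    · intro hcb
      by_cases htb' : (openGraph ω).Reachable t b
      · exact Or.inl (Or.inl ⟨hcb, htb'⟩)
      · by_cases hab' : (openGraph ω).Reachable a b
        · refine Or.inr ⟨⟨hab'.trans hcb.symm, hab'⟩, fun hta => htb' (hta.trans hab'), ?_⟩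
          exact fun htc => htb' (htc.trans hcb)
        · exact Or.inl (Or.inr ⟨hcb, fun hac => hab' (hac.trans hcb), fun htc => htb' (htc.trans hcb)⟩)
    · rintro ((⟨hcb, -⟩ | ⟨hcb, -⟩) | ⟨⟨hac, hab'⟩, -⟩)
      · exact hcb
      · exact hcb
      · exact hac.symm.trans hab'
  have d1 : Disjoint (openConn c b ∩ openConn t b ∪ openConn c b ∩ DK) (g8 ∩ Dt) := by
    rw [Set.disjoint_union_left]; constructor
    · rw [Set.disjoint_left]; rintro ω ⟨-, htb'⟩ ⟨⟨-, hab'⟩, hDt'⟩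
      have hab'' : (openGraph ω).Reachable a b := hab'
      have htb'' : (openGraph ω).Reachable t b := htb'
      exact ((memDt ω).1 hDt').1 (htb''.trans hab''.symm)
    · rw [Set.disjoint_left]; rintro ω ⟨-, hDK'⟩ ⟨⟨hac, -⟩, -⟩
      exact ((memDK ω).1 hDK').1 hac
  have d2 : Disjoint (openConn c b ∩ openConn t b) (openConn c b ∩ DK) := by
    rw [Set.disjoint_left]; rintro ω ⟨hcb, htb'⟩ ⟨-, hDK'⟩
    have htb'' : (openGraph ω).Reachable t b := htb'
    have hcb' : (openGraph ω).Reachable c b := hcb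
    exact ((memDK ω).1 hDK').2 (htb''.trans hcb'.symm)
  conv_lhs => rw [e]
  rw [measureReal_union d1 (hmeas _), measureReal_union d2 (hmeas _)]

/-- `P(t↔b) = P(c↔b, t↔b) + μ({a↔t, b∈C_{at}} ∩ D_K) + μ({t↔b} ∩ D_t)`. [cite: KozmaNitzan2024, Thm. 2 proof, (7) (p. 8)] -/
theorem real_tb_split (w : Sym2 V → unitInterval) (a t c b : V) :
    (prodBernoulli w).real (openConn t b) = (prodBernoulli w).real (openConn c b ∩ openConn t b) + (prodBernoulli w).real ((openConn a t ∩ (openConn a b ∪ openConn t b)) ∩ avoidSet ({a, t} : Set V) {c}) +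
      (prodBernoulli w).real (openConn t b ∩ avoidSet ({t} : Set V) {a, c}) := by
  classical
  set μ := prodBernoulli w with hμ
  have hmeas : ∀ A : Set (BondConfig V), MeasurableSet A := fun _ => MeasurableSet.of_discrete
  set DK : Set (BondConfig V) := avoidSet {a, t} {c} with hDK
  set Da : Set (BondConfig V) := avoidSet {a} {t, c} with hDa
  set Dt : Set (BondConfig V) := avoidSet {t} {a, c} with hDt
  set h5 : Set (BondConfig V) := openConn a t ∩ (openConn a b ∪ openConn t b) with hh5
  set g9 : Set (BondConfig V) := openConn t c ∩ openConn t b with hg9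
  set g8 : Set (BondConfig V) := openConn a c ∩ openConn a b with hg8
  have memDK : ∀ ω, ω ∈ DK ↔ ¬ (openGraph ω).Reachable a c ∧ ¬ (openGraph ω).Reachable t c := fun ω => by
    rw [hDK]; exact mem_avoidSet_two_one a t c ω
  have memDa : ∀ ω, ω ∈ Da ↔ ¬ (openGraph ω).Reachable a t ∧ ¬ (openGraph ω).Reachable a c := fun ω => by
    rw [hDa]; exact mem_avoidSet_one_two a t c ω
  have memDt : ∀ ω, ω ∈ Dt ↔ ¬ (openGraph ω).Reachable t a ∧ ¬ (openGraph ω).Reachable t c := fun ω => by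
    rw [hDt]; exact mem_avoidSet_one_two t a c ω
  have e : (openConn t b : Set (BondConfig V)) = openConn c b ∩ openConn t b ∪ h5 ∩ DK ∪ openConn t b ∩ Dt := by
    ext ω
    simp only [Set.mem_union, Set.mem_inter_iff, memDK, memDt, hh5, openConn, Set.mem_setOf_eq]
    constructor
    · intro htb'
      by_cases hcb : (openGraph ω).Reachable c b
      · exact Or.inl (Or.inl ⟨hcb, htb'⟩)
      · by_cases hat : (openGraph ω).Reachable a t
        · refine Or.inl (Or.inr ⟨⟨hat, Or.inr htb'⟩, ?_, fun htc => hcb (htc.symm.trans htb')⟩)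
          exact fun hac => hcb (hac.symm.trans (hat.trans htb'))
        · exact Or.inr ⟨htb', fun hta => hat hta.symm, fun htc => hcb (htc.symm.trans htb')⟩
    · rintro ((⟨-, htb'⟩ | ⟨⟨hat, hb⟩, -⟩) | ⟨htb', -⟩)
      · exact htb'
      · rcases hb with h | h
        · exact hat.symm.trans h
        · exact h
      · exact htb'
  have d1 : Disjoint (openConn c b ∩ openConn t b ∪ h5 ∩ DK) (openConn t b ∩ Dt) := by
    rw [Set.disjoint_union_left]; constructor
    · rw [Set.disjoint_left]; rintro ω ⟨hcb, htb'⟩ ⟨-, hDt'⟩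
      have htb'' : (openGraph ω).Reachable t b := htb'
      have hcb' : (openGraph ω).Reachable c b := hcb
      exact ((memDt ω).1 hDt').2 (htb''.trans hcb'.symm)
    · rw [Set.disjoint_left]; rintro ω ⟨⟨hat, -⟩, -⟩ ⟨-, hDt'⟩
      exact ((memDt ω).1 hDt').1 hat.symm
  have d2 : Disjoint (openConn c b ∩ openConn t b) (h5 ∩ DK) := by
    rw [Set.disjoint_left]; rintro ω ⟨hcb, htb'⟩ ⟨-, hDK'⟩
    have htb'' : (openGraph ω).Reachable t b := htb'
    have hcb' : (openGraph ω).Reachable c b := hcb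
    exact ((memDK ω).1 hDK').2 (htb''.trans hcb'.symm)
  conv_lhs => rw [e]
  rw [measureReal_union d1 (hmeas _), measureReal_union d2 (hmeas _)]

/-- `m_c`: `{c↔b, a↮b, t↮b} = {c↔b} ∩ D_K`. [cite: KozmaNitzan2024, p. 8 (definition of `m_S`)] -/
theorem mc_set_eq (w : Sym2 V → unitInterval) (a t c b : V) :
    openConn c b ∩ (openConn a b)ᶜ ∩ (openConn t b)ᶜ = openConn c b ∩ avoidSet ({a, t} : Set V) {c} := by
  classical
  set μ := prodBernoulli w with hμ
  have hmeas : ∀ A : Set (BondConfig V), MeasurableSet A := fun _ => MeasurableSet.of_discrete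
  set DK : Set (BondConfig V) := avoidSet {a, t} {c} with hDK
  set Da : Set (BondConfig V) := avoidSet {a} {t, c} with hDa
  set Dt : Set (BondConfig V) := avoidSet {t} {a, c} with hDt
  set h5 : Set (BondConfig V) := openConn a t ∩ (openConn a b ∪ openConn t b) with hh5
  set g9 : Set (BondConfig V) := openConn t c ∩ openConn t b with hg9
  set g8 : Set (BondConfig V) := openConn a c ∩ openConn a b with hg8
  have memDK : ∀ ω, ω ∈ DK ↔ ¬ (openGraph ω).Reachable a c ∧ ¬ (openGraph ω).Reachable t c := fun ω => by
    rw [hDK]; exact mem_avoidSet_two_one a t c ω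
  have memDa : ∀ ω, ω ∈ Da ↔ ¬ (openGraph ω).Reachable a t ∧ ¬ (openGraph ω).Reachable a c := fun ω => by
    rw [hDa]; exact mem_avoidSet_one_two a t c ω
  have memDt : ∀ ω, ω ∈ Dt ↔ ¬ (openGraph ω).Reachable t a ∧ ¬ (openGraph ω).Reachable t c := fun ω => by
    rw [hDt]; exact mem_avoidSet_one_two t a c ω
  ext ω
  simp only [Set.mem_inter_iff, Set.mem_compl_iff, memDK, openConn, Set.mem_setOf_eq]
  constructor
  · rintro ⟨⟨hcb, hab'⟩, htb'⟩
    exact ⟨hcb, fun hac => hab' (hac.trans hcb), fun htc => htb' (htc.trans hcb)⟩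
  · rintro ⟨hcb, hac, htc⟩
    exact ⟨⟨hcb, fun hab' => hac (hab'.trans hcb.symm)⟩, fun htb' => htc (htb'.trans hcb.symm)⟩

/-- `m_{at}`: `{a↔b, t↔b, c↮b} = {a↔t, b∈C_{at}} ∩ D_K`. [cite: KozmaNitzan2024, p. 8 (definition of `m_S`)] -/
theorem mK_set_eq (w : Sym2 V → unitInterval) (a t c b : V) :
    openConn a b ∩ openConn t b ∩ (openConn c b)ᶜ = (openConn a t ∩ (openConn a b ∪ openConn t b)) ∩ avoidSet ({a, t} : Set V) {c} := by
  classical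
  set μ := prodBernoulli w with hμ
  have hmeas : ∀ A : Set (BondConfig V), MeasurableSet A := fun _ => MeasurableSet.of_discrete
  set DK : Set (BondConfig V) := avoidSet {a, t} {c} with hDK
  set Da : Set (BondConfig V) := avoidSet {a} {t, c} with hDa
  set Dt : Set (BondConfig V) := avoidSet {t} {a, c} with hDt
  set h5 : Set (BondConfig V) := openConn a t ∩ (openConn a b ∪ openConn t b) with hh5
  set g9 : Set (BondConfig V) := openConn t c ∩ openConn t b with hg9
  set g8 : Set (BondConfig V) := openConn a c ∩ openConn a b with hg8
  have memDK : ∀ ω, ω ∈ DK ↔ ¬ (openGraph ω).Reachable a c ∧ ¬ (openGraph ω).Reachable t c := fun ω => by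
    rw [hDK]; exact mem_avoidSet_two_one a t c ω
  have memDa : ∀ ω, ω ∈ Da ↔ ¬ (openGraph ω).Reachable a t ∧ ¬ (openGraph ω).Reachable a c := fun ω => by
    rw [hDa]; exact mem_avoidSet_one_two a t c ω
  have memDt : ∀ ω, ω ∈ Dt ↔ ¬ (openGraph ω).Reachable t a ∧ ¬ (openGraph ω).Reachable t c := fun ω => by
    rw [hDt]; exact mem_avoidSet_one_two t a c ω
  ext ω
  simp only [Set.mem_inter_iff, Set.mem_compl_iff, memDK, hh5, Set.mem_union, openConn, Set.mem_setOf_eq]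
  constructor
  · rintro ⟨⟨hab', htb'⟩, hcb⟩
    exact ⟨⟨hab'.trans htb'.symm, Or.inl hab'⟩, fun hac => hcb (hac.symm.trans hab'),
      fun htc => hcb (htc.symm.trans htb')⟩
  · rintro ⟨⟨hat, hb⟩, hac, htc⟩
    have hab' : (openGraph ω).Reachable a b := by
      rcases hb with h | h
      · exact h
      · exact hat.trans h
    exact ⟨⟨hab', hat.symm.trans hab'⟩, fun hcb => hac (hab'.trans hcb.symm)⟩


end KNGoodThreeKN

end Summit.CriticalPhenomena.PercolationContinuityZ3.Theorems
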